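import Mathlib
import HarnessLib
import Literature.NumberTheory.LFunctions.RiemannXi
import Literature.NumberTheory.LFunctions.RiemannXiLogDeriv
import Summits.RiemannHypothesis.RiemannHypothesis.Theorems.DeBrangesSuzukiDoorDefs
import Summits.RiemannHypothesis.RiemannHypothesis.Theorems.DeBrangesSuzukiDoorKernelSupportSymbolDecayUniform
import Summits.RiemannHypothesis.RiemannHypothesis.Theorems.DeBrangesSuzukiDoorKernelSupportLineIndependence
import Summits.RiemannHypothesis.RiemannHypothesis.Theorems.DeBrangesSuzukiDoorKernelSupportVanishingGeneric

/-!
# RiemannHypothesis / DeBrangesSuzukiDoor — crux `KernelLaplaceIdentity` (K4), stubs `stub_lineContinuous`, `stub_reality`, `stub_support`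

Registered stubs of the BC3 birth skeleton of `DeBrangesSuzukiDoor.KernelLaplaceIdentity` (stmt-RiemannHypothesis-19726;
planner rh-dbr-theory g4, `KernelLaplaceIdentity_line_birth.lean` sha16 c189badcad3d5763), proved BY NAME with the
registered signatures (namespace `…Cruxes.KernelLaplaceIdentity.Birth`, `thetaSym`/`invFL` from the Defs file):
* `stub_lineContinuous`: for `b ≥ 1`, `u ↦ Θ_θ(u + ib)` is continuous (`ξ ≠ 0` on `Re s = ½ + b ≥ 3/2`; tree
  `continuous_logDeriv_riemannXi_vertical`).
* `stub_reality`: `(invFL Θ_θ b x).im = 0` by the conjugation symmetry `Θ_θ(−u+ib) = conj Θ_θ(u+ib)`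
  (`logDeriv_riemannXi_conj`), `integral_conj` and `integral_neg_eq_self`.
* `stub_support`: K3 in `thetaSym` form, composed from the three landed K3 stubs.
The shared children `stub_symbolDecayUniform` / `stub_lineIndependence` are the landed K3-namespace theorems
`…Cruxes.KernelSupport.Birth.stub_symbolDecayUniform` / `….stub_lineIndependence` (same terms by `rfl`; not
re-declared here). The crux itself is closed (`kernelLaplaceIdentity_proof`). RH-FREE; nothing here bears on RH.
-/

noncomputable section

-- D-0017: `Summit.<S>.<S>.…` is the designed namespace of a single-problem summit.
set_option linter.dupNamespace false

open Complex MeasureTheory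
open scoped ComplexConjugate

namespace Summit.RiemannHypothesis.RiemannHypothesis.Cruxes.KernelLaplaceIdentity.Birth

open Literature.NumberTheory.LFunctions

/-- **Registered stub `stub_lineContinuous` of crux `KernelLaplaceIdentity` (PROVED, RH-FREE).** -/
theorem stub_lineContinuous : ∀ θ : ℝ, 10 < θ → ∀ b : ℝ, 1 ≤ b →
    Continuous (fun u : ℝ => thetaSym θ ((u : ℂ) + (b : ℂ) * Complex.I)) := by
  intro θ _ b hb
  have hL : Continuous fun u : ℝ => logDeriv riemannXi (((1 / 2 + b : ℝ) : ℂ) + ((-u : ℝ) : ℂ) * I) :=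
    (continuous_logDeriv_riemannXi_vertical (c := 1 / 2 + b) (by linarith)).comp continuous_neg
  have : (fun u : ℝ => thetaSym θ ((u : ℂ) + (b : ℂ) * I)) =
      fun u : ℝ => Complex.exp (-2 * (θ : ℂ) *
        logDeriv riemannXi (((1 / 2 + b : ℝ) : ℂ) + ((-u : ℝ) : ℂ) * I)) := by
    funext u
    simp only [thetaSym, Summit.RiemannHypothesis.RiemannHypothesis.Cruxes.KernelSupport.Birth.half_sub_I_mul_line_b,
      logDeriv_apply]
  rw [this]
  exact (continuous_const.mul hL).cexp

/-- Conjugation symmetry of the symbol on horizontal lines: `Θ_θ(−u + ib) = conj Θ_θ(u + ib)`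
(from `ξ'/ξ(conj s) = conj ξ'/ξ(s)`, tree `logDeriv_riemannXi_conj`). -/
theorem thetaSym_neg_conj (θ u b : ℝ) :
    thetaSym θ (((-u : ℝ) : ℂ) + (b : ℂ) * Complex.I) = conj (thetaSym θ ((u : ℂ) + (b : ℂ) * Complex.I)) := by
  have hs : (1 : ℂ) / 2 - I * (((-u : ℝ) : ℂ) + (b : ℂ) * I) = conj ((1 : ℂ) / 2 - I * ((u : ℂ) + (b : ℂ) * I)) := by
    apply Complex.ext <;> simp
  simp only [thetaSym]
  have h1 : conj (-2 * (θ : ℂ)) = -2 * (θ : ℂ) := by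
    rw [map_mul, map_neg, map_ofNat, Complex.conj_ofReal]
  have h2 : deriv riemannXi ((1 : ℂ) / 2 - I * (((-u : ℝ) : ℂ) + (b : ℂ) * I)) /
      riemannXi ((1 : ℂ) / 2 - I * (((-u : ℝ) : ℂ) + (b : ℂ) * I)) =
      conj (deriv riemannXi ((1 : ℂ) / 2 - I * ((u : ℂ) + (b : ℂ) * I)) /
        riemannXi ((1 : ℂ) / 2 - I * ((u : ℂ) + (b : ℂ) * I))) := by
    have h := logDeriv_riemannXi_conj ((1 : ℂ) / 2 - I * ((u : ℂ) + (b : ℂ) * I))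
    rw [logDeriv_apply, logDeriv_apply] at h
    rw [hs, h]
  rw [← Complex.exp_conj, map_mul, h1, h2]

/-- **Registered stub `stub_reality` of crux `KernelLaplaceIdentity` (PROVED, RH-FREE).** The inverse transform of
`Θ_θ` along any line `Im z = b` is real: the integrand at `−u` is the conjugate of the integrand at `u`
(`Θ_θ(−u+ib) = conj Θ_θ(u+ib)`, `e^{−i(−u+ib)x} = conj e^{−i(u+ib)x}`), so the line integral equals its conjugate
(`integral_conj`, `integral_neg_eq_self`), and the prefactor `1/2π` is real. -/
theorem stub_reality : ∀ θ : ℝ, 10 < θ → ∀ b : ℝ, 1 ≤ b → ∀ x : ℝ,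
    (invFL (thetaSym θ) b x).im = 0 := by
  intro θ _ b _ x
  rw [← Complex.conj_eq_iff_im]
  unfold invFL
  rw [map_mul]
  have hc : conj ((1 : ℂ) / (2 * (Real.pi : ℂ))) = (1 : ℂ) / (2 * (Real.pi : ℂ)) := by
    rw [map_div₀, map_mul, map_one, map_ofNat, Complex.conj_ofReal]
  rw [hc, ← integral_conj]
  congr 1
  have h : (fun u : ℝ => conj (thetaSym θ ((u : ℂ) + (b : ℂ) * Complex.I) *
        Complex.exp (-Complex.I * ((u : ℂ) + (b : ℂ) * Complex.I) * (x : ℂ)))) =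
      fun u : ℝ => thetaSym θ (((-u : ℝ) : ℂ) + (b : ℂ) * Complex.I) *
        Complex.exp (-Complex.I * (((-u : ℝ) : ℂ) + (b : ℂ) * Complex.I) * (x : ℂ)) := by
    funext u
    rw [map_mul, thetaSym_neg_conj, ← Complex.exp_conj]
    congr 2
    apply Complex.ext <;> simp
  rw [h]
  exact integral_neg_eq_self
    (fun u : ℝ => thetaSym θ ((u : ℂ) + (b : ℂ) * Complex.I) *
      Complex.exp (-Complex.I * ((u : ℂ) + (b : ℂ) * Complex.I) * (x : ℂ))) volume

/-- **Registered stub `stub_support` of crux `KernelLaplaceIdentity` (PROVED, RH-FREE)** — the sibling crux K3 in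
`thetaSym` form: composition of the three K3 stubs (decay, line independence, generic vanishing). -/
theorem stub_support : ∀ θ : ℝ, 10 < θ → ∀ x : ℝ, x < 0 → invFL (thetaSym θ) 1 x = 0 := by
  intro θ hθ
  obtain ⟨C, hC⟩ := Summit.RiemannHypothesis.RiemannHypothesis.Cruxes.KernelSupport.Birth.stub_symbolDecayUniform θ hθ
  exact Summit.RiemannHypothesis.RiemannHypothesis.Cruxes.KernelSupport.Birth.stub_vanishingGeneric _ C (θ / 10)
    (by linarith) hC (Summit.RiemannHypothesis.RiemannHypothesis.Cruxes.KernelSupport.Birth.stub_lineIndependence θ hθ)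

end Summit.RiemannHypothesis.RiemannHypothesis.Cruxes.KernelLaplaceIdentity.Birth

end
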